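import Literature.AlgebraicGeometry.Resolution.FibreComponentsBaseChange
import Literature.AlgebraicGeometry.Dimension.PointDimension
import Mathlib.AlgebraicGeometry.Fiber
import HarnessLib

/-!
# Fibres over closed points in an affine chart: points, extended ideals and dimensions of components

Topic: `Literature/AlgebraicGeometry/Resolution`. The dictionary between the fibre `f⁻¹(y)` of a
morphism `f : X → Y` over a closed point `y` of an affine open `U = Spec B ⊆ Y` and the primes of
an affine open `W = Spec A ⊆ f⁻¹(U)` of `X` (Hartshorne II.3, fibres; Görtz–Wedhorn I, (4.10)):

* `primeIdealOf_fromSpec` — `𝔭_W` and `Spec A → W` are inverse bijections;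
* `apply_fromSpec_eq_iff_map_le` — **the points of `W ∩ f⁻¹(y)` are the primes of `A` containing
  `𝔫A`**, `𝔫 = 𝔭_U(y)` the maximal ideal of `y` (a prime `𝔮` of `A` maps to `y` iff
  `φ⁻¹𝔮 = 𝔫` iff `𝔫A ⊆ 𝔮`, `φ = f^♯ : B → A`);
* `isMax_fiber_of_mem_minimalPrimes` — the point of a minimal prime of `𝔫A` is a maximal point
  (generic point of an irreducible component) of the fibre scheme `X_y`;
* `ringKrullDim_quotient_eq_of_mem_minimalPrimes` — **for `X` locally of finite type over a field,
  if every irreducible component of every fibre `X_y` has dimension `d`, then `dim A/P = d` for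
  every minimal prime `P` of `𝔫A`** (chart formula for the dimension of a point,
  `Literature.AlgebraicGeometry.Dimension.Scheme.height_eq_ringKrullDim_quotient_primeIdealOf`,
  Görtz–Wedhorn I Thm. 5.22, and `dim C = height` of the generic point,
  `topologicalKrullDim_closure_singleton_eq_height`).

This is the translation used to feed de Jong's dimension count in the proof of Lemma 4.13
(de Jong 1996, pp. 69–70) with its ring-theoretic form
(`GenericFormMissesFibreComponents.lean`).

## References

* R. Hartshorne, *Algebraic Geometry*, GTM 52 (1977), II.3 (fibres, p. 89). [Hartshorne1977]
* U. Görtz, T. Wedhorn, *Algebraic Geometry I*, 2nd ed. (2020), (4.10), Thm. 5.22.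
  [GortzWedhorn2020]
-/

noncomputable section

universe u

open CategoryTheory AlgebraicGeometry Order Topology TopologicalSpace

namespace Literature.AlgebraicGeometry.Resolution

variable {X Y : Scheme.{u}} (f : X ⟶ Y) {U : Y.Opens} (hU : IsAffineOpen U) {W : X.Opens}
  (hW : IsAffineOpen W) (hWU : W ≤ f ⁻¹ᵁ U)

/-! ### Points of an affine open and primes -/

omit f in
/-- `Spec Γ(X, W) → X` lands in `W`. [folklore] -/
theorem fromSpec_mem (p : PrimeSpectrum Γ(X, W)) : hW.fromSpec p ∈ W := by
  have : hW.fromSpec p ∈ Set.range hW.fromSpec := Set.mem_range_self p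
  rwa [IsAffineOpen.range_fromSpec] at this

omit f in
/-- `𝔭_W(Spec Γ(X, W) → X (p)) = p`: the prime of the point of a prime. [folklore] -/
theorem primeIdealOf_fromSpec (p : PrimeSpectrum Γ(X, W)) :
    hW.primeIdealOf ⟨hW.fromSpec p, fromSpec_mem hW p⟩ = p := by
  apply hW.fromSpec.isOpenEmbedding.injective
  rw [IsAffineOpen.fromSpec_primeIdealOf]

omit f in
/-- Points of `W` with the same prime are equal. [folklore] -/
theorem primeIdealOf_injective : Function.Injective hW.primeIdealOf := fun a b h => by
  have := congrArg hW.fromSpec h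
  rw [IsAffineOpen.fromSpec_primeIdealOf, IsAffineOpen.fromSpec_primeIdealOf] at this
  exact Subtype.ext this

/-! ### The fibre over a closed point in the chart -/

/-- **The points of `W ∩ f⁻¹(y)` are the primes containing `𝔫A`.** For `y ∈ U` with maximal prime
`𝔫 = 𝔭_U(y) ⊆ B = Γ(Y, U)` (e.g. a closed point) and a prime `p` of `A = Γ(X, W)`,
`W ⊆ f⁻¹(U)`: the point of `p` maps to `y` iff `𝔫A ⊆ p`, where `𝔫A` is the extension along
`f^♯ : B → A`. [folklore] -/
theorem apply_fromSpec_eq_iff_map_le (y : U) (hy : (hU.primeIdealOf y).asIdeal.IsMaximal)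
    (p : PrimeSpectrum Γ(X, W)) :
    f (hW.fromSpec p) = (y : Y) ↔
      (hU.primeIdealOf y).asIdeal.map (f.appLE U W hWU).hom ≤ p.asIdeal := by
  have hx : hW.fromSpec p ∈ W := fromSpec_mem hW p
  have key := IsAffineOpen.comap_primeIdealOf_appLE U hU W hW hWU hx
  rw [primeIdealOf_fromSpec] at key
  -- `key : p.comap φ = 𝔭_U(f x)`
  have hkey : p.asIdeal.comap (f.appLE U W hWU).hom = (hU.primeIdealOf ⟨f (hW.fromSpec p), hWU hx⟩).asIdeal :=
    congrArg PrimeSpectrum.asIdeal key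
  rw [Ideal.map_le_iff_le_comap, hkey]
  constructor
  · intro h
    have : (⟨f (hW.fromSpec p), hWU hx⟩ : U) = y := Subtype.ext h
    rw [this]
  · intro h
    have h2 : (hU.primeIdealOf y).asIdeal = (hU.primeIdealOf ⟨f (hW.fromSpec p), hWU hx⟩).asIdeal :=
      hy.eq_of_le (Ideal.IsPrime.ne_top inferInstance) h
    have h3 : y = ⟨f (hW.fromSpec p), hWU hx⟩ :=
      primeIdealOf_injective hU (PrimeSpectrum.ext h2)
    exact (congrArg Subtype.val h3).symm

/-- For a closed point `y ∈ U` of `Y` the prime `𝔭_U(y)` is maximal (Mathlib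
`primeIdealOf_isMaximal_of_isClosed`, restated with the membership hypothesis explicit).
[folklore] -/
theorem isMaximal_primeIdealOf_of_isClosed {y : Y} (hyU : y ∈ U) (hy : IsClosed ({y} : Set Y)) :
    (hU.primeIdealOf ⟨y, hyU⟩).asIdeal.IsMaximal :=
  hU.primeIdealOf_isMaximal_of_isClosed ⟨y, hyU⟩ hy

/-! ### Minimal primes of `𝔫A` are generic points of components of the fibre scheme -/

/-- The fibre `X_y ↪ X` over a closed point is a closed embedding. [folklore] -/
theorem isClosedEmbedding_fiberι {y : Y} (hy : IsClosed ({y} : Set Y)) :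
    IsClosedEmbedding (f.fiberι y) :=
  ⟨(f.fiberι y).isEmbedding, by
    rw [Scheme.Hom.range_fiberι]
    exact hy.preimage f.continuous⟩

/-- **The point of a minimal prime of `𝔫A` is a maximal point of the fibre scheme `X_y`**
(no proper generisation): a generisation `z'` of it in `X_y` gives a point `x' ⤳ x` of `X` over
`y`, which lies in the open `W`, i.e. a prime `p' ⊆ P` containing `𝔫A`, so `p' = P`.
[folklore] -/
theorem isMax_fiber_of_mem_minimalPrimes (y : U) (hy : (hU.primeIdealOf y).asIdeal.IsMaximal)
    {P : Ideal Γ(X, W)}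
    (hP : P ∈ ((hU.primeIdealOf y).asIdeal.map (f.appLE U W hWU).hom).minimalPrimes)
    (z : ↥(f.fiber (y : Y))) (hz : f.fiberι (y : Y) z = hW.fromSpec ⟨P, hP.1.1⟩) : IsMax z := by
  haveI : P.IsPrime := hP.1.1
  intro z' hzz'
  -- `z ≤ z'` means `z' ⤳ z`
  have hsp : z' ⤳ z := Scheme.le_iff_specializes.mp hzz'
  apply le_of_eq
  -- the point `x' = ι z'` generises `x`, lies in `W` and over `y`
  set x' := f.fiberι (y : Y) z' with hx'
  have hxx : x' ⤳ hW.fromSpec ⟨P, hP.1.1⟩ := hz ▸ hsp.map (f.fiberι (y : Y)).continuous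
  have hx'W : x' ∈ W := hxx.mem_open W.2 (fromSpec_mem hW _)
  have hfx' : f x' = y := by
    have : x' ∈ Set.range (f.fiberι (y : Y)) := ⟨z', rfl⟩
    rw [Scheme.Hom.range_fiberι] at this
    exact this
  set p' := hW.primeIdealOf ⟨x', hx'W⟩ with hp'
  have hx'eq : hW.fromSpec p' = x' := hW.fromSpec_primeIdealOf ⟨x', hx'W⟩
  -- `𝔫A ⊆ p' ⊆ P`
  have hle' : (hU.primeIdealOf y).asIdeal.map (f.appLE U W hWU).hom ≤ p'.asIdeal := by
    rw [← apply_fromSpec_eq_iff_map_le f hU hW hWU y hy p', hx'eq]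
    exact hfx'
  have hp'P : p' ≤ ⟨P, hP.1.1⟩ := by
    rw [← Literature.AlgebraicGeometry.Dimension.Scheme.fromSpec_specializes_iff hW, hx'eq]
    exact hxx
  have heq : p'.asIdeal = P := le_antisymm hp'P (hP.2 ⟨p'.isPrime, hle'⟩ hp'P)
  -- hence `x' = x` and `z' = z`
  have hxeq : x' = hW.fromSpec ⟨P, hP.1.1⟩ := by
    rw [← hx'eq]
    congr 1
    exact PrimeSpectrum.ext heq
  have hzeq : z' = z := (f.fiberι (y : Y)).isEmbedding.injective (hxeq.trans hz.symm)
  rw [hzeq]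

include hW in
/-- **Components of the fibres of dimension `d` ⇒ `dim A/P = d` for the minimal primes of `𝔫A`.**
Let `X` be locally of finite type over a field `k`, `f : X → Y`, `U = Spec B ⊆ Y` and
`W = Spec A ⊆ f⁻¹(U)` affine opens, `y ∈ U` a closed point of `Y` with maximal ideal `𝔫 ⊆ B`,
and suppose every irreducible component of the fibre scheme `X_y` has dimension `d`. Then
`dim A/P = d` for every minimal prime `P` of `𝔫A`: the point `x` of `P` is the generic point of a
component `C` of `X_y` (`isMax_fiber_of_mem_minimalPrimes`), `dim A/P = height x`
(Görtz–Wedhorn I Thm. 5.22, the chart formula), heights in `X_y ↪ X` agree over the closed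
point `y`, and `height = dim C = d`. [cite: GortzWedhorn2020, Thm. 5.22] -/
theorem ringKrullDim_quotient_eq_of_mem_minimalPrimes {k : Type u} [Field k]
    (gX : X ⟶ Spec (.of k)) [LocallyOfFiniteType gX] {d : ℕ} {y : Y} (hyU : y ∈ U)
    (hy : IsClosed ({y} : Set Y))
    (hdim : ∀ C ∈ irreducibleComponents ↥(f.fiber y), topologicalKrullDim ↥C = d)
    {P : Ideal Γ(X, W)}
    (hP : P ∈ ((hU.primeIdealOf ⟨y, hyU⟩).asIdeal.map (f.appLE U W hWU).hom).minimalPrimes) :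
    ringKrullDim (Γ(X, W) ⧸ P) = d := by
  haveI : P.IsPrime := hP.1.1
  have hymax := isMaximal_primeIdealOf_of_isClosed hU hyU hy
  set p : PrimeSpectrum Γ(X, W) := ⟨P, hP.1.1⟩ with hpdef
  set x := hW.fromSpec p with hxdef
  have hxW : x ∈ W := fromSpec_mem hW p
  have hfx : f x = y := (apply_fromSpec_eq_iff_map_le f hU hW hWU ⟨y, hyU⟩ hymax p).mpr hP.1.2
  -- the point `z` of the fibre scheme
  obtain ⟨z, hz⟩ : x ∈ Set.range (f.fiberι y) := by
    rw [Scheme.Hom.range_fiberι]; exact hfx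
  have hzmax : IsMax z := isMax_fiber_of_mem_minimalPrimes f hU hW hWU ⟨y, hyU⟩ hymax hP z hz
  -- `closure {z}` is a component, of dimension `d = height z`
  have hgen : closure ({z} : Set ↥(f.fiber y)) ∈ irreducibleComponents ↥(f.fiber y) :=
    (mem_genericPoints_iff_isMax z).mpr hzmax
  have h1 := hdim _ hgen
  rw [topologicalKrullDim_closure_singleton_eq_height z] at h1
  -- `height z = height x` (closed embedding `X_y ↪ X`) and the chart formula
  have h2 : height x = height z := by
    rw [← hz]
    exact Literature.AlgebraicGeometry.Motives.Scheme.height_base_eq_of_isClosedEmbedding _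
      (isClosedEmbedding_fiberι f hy) z
  have h3 := Literature.AlgebraicGeometry.Dimension.Scheme.height_eq_ringKrullDim_quotient_primeIdealOf
    gX hW hxW
  rw [show hW.primeIdealOf ⟨x, hxW⟩ = p from primeIdealOf_fromSpec hW p] at h3
  rw [← h3, h2]
  have h1' : (height z : ℕ∞) = d := by exact_mod_cast h1
  rw [h1']
  rfl

end Literature.AlgebraicGeometry.Resolution
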